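import Summits.NavierStokesRegularity.NavierStokesRegularity.Theses.RellichScar
import Summits.NavierStokesRegularity.NavierStokesRegularity.Theorems.ScarRigidity.Negative.LogicAndLoadBearing
import Summits.NavierStokesRegularity.NavierStokesRegularity.Theorems.RellichScarDefs
import Summits.NavierStokesRegularity.NavierStokesRegularity.Theorems.RellichScarScarRigidityApexMild
import Summits.NavierStokesRegularity.NavierStokesRegularity.Theorems.RellichScarScarRigidityApexRegularity
import Summits.NavierStokesRegularity.NavierStokesRegularity.Theorems.RellichScarScarRigidityMomentLadderReduction
import Summits.NavierStokesRegularity.NavierStokesRegularity.Theorems.RellichScarSelfSimilarApexFatal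
import Summits.NavierStokesRegularity.NavierStokesRegularity.Theorems.RellichScarAxisymmetricApexFatal
import Summits.NavierStokesRegularity.NavierStokesRegularity.Theorems.RellichScarSimilarityCovariance
import Summits.NavierStokesRegularity.NavierStokesRegularity.Theorems.RellichScarSymmetricScarExistsRotWindowRigidity
import Summits.NavierStokesRegularity.NavierStokesRegularity.Theorems.RellichScarScarRigidityDilationGeneratorFlat
import Summits.NavierStokesRegularity.NavierStokesRegularity.Theorems.RellichScarScarRigidityZoomOrbitIncrement
import Summits.NavierStokesRegularity.NavierStokesRegularity.Theorems.RellichScarScarRigidityRotationGeneratorFlat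
import Summits.NavierStokesRegularity.NavierStokesRegularity.Theorems.RellichScarScarRigidityRotationOrbitIncrement
import Literature.Analysis.FluidPDE.TypeIAncientMild
import Literature.Analysis.FluidPDE.AncientLimitVanishingScaled
import Literature.Analysis.FluidPDE.SwirlTransportProofs
import HarnessLib

/-!
# `ScarRigidity` — line `SketchIdeator6` (generator–hull / local scar uniqueness), lead a3
# (crux stmt-NavierStokesRegularity-11717, route RellichScar)

SKELETON.  The crux `RellichScar.ScarRigidity` ("two singular apex Type-I profiles with the same scar coincide")
is composed, sorry-free modulo the registered `stub_*` below, as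

  `ScarRigidity ⇐ SymmetricScarExists (item 11718) ∧ NoHomogeneousScarProfile ∧ NoAxisymmetricScarProfile`
  (pure logic: `exists_singular_apex_of_not_scarRigidity`), and
  `NoHomogeneousScarProfile ∧ NoAxisymmetricScarProfile ⇐ stub_localScarUniqueness` (ISOLATION of a singular
  apex profile among its scar twins in the scale-invariant weighted sup-norm
  `‖W‖_* = sup (‖x‖+√(−t))³‖W(t,x)‖/(−t)`) `+` four provable platform stubs:
  a (−1)-homogeneous (resp. axisymmetric) scar makes the SPATIAL DILATION generator `V + x·∇V`
  (resp. the ROTATION generator `J V − ∇V·(J x)`) a zero-scar field of finite `‖·‖_*`-norm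
  (`stub_dilationGeneratorFlat`, `stub_rotationGeneratorFlat`), whence the symmetry orbit
  `λ ↦ V_λ = λV(λ²·,λ·)` (resp. `θ ↦ R_θ V(·,R_{−θ}·)`) is LIPSCHITZ into `‖·‖_*` at the profile
  (`stub_zoomOrbitIncrement`, `stub_rotationOrbitIncrement`); isolation then freezes the orbit near the
  identity, the stabiliser is an open subgroup of a connected group, so the profile is exactly self-similar
  (resp. axisymmetric), which the landed Fatal supports (Tsai 1998 / Seregin–Šverák 2009) forbid.

Stubs (registered with `ledger skeleton check`):
* `stub_symmetricScarExists` — VERBATIM the route item stmt-NavierStokesRegularity-11718 (sibling crux).  DELEGATED to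
  that item's own chain; never worked in this line (replace by `SymmetricScarExists_holds` when it closes).
* `stub_localScarUniqueness` — OPEN core (held by the lead): every singular smooth apex profile is isolated among
  its singular scar twins in `‖·‖_*`.  Implied by the crux; implies the two one-parameter statements the route's
  `closes` consumes; irrefutable by construction (Disproof §1).
* `stub_dilationGeneratorFlat`, `stub_zoomOrbitIncrement`, `stub_rotationGeneratorFlat`,
  `stub_rotationOrbitIncrement` — LANDED (p129707, p129650, p130364, p129583): MVT in time from the zero scar of the
  generator (pattern of the landed `stub_farFieldOfScar`), only FIRST time derivatives of the package are used.
-/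

noncomputable section

open Set Filter Function MeasureTheory Metric TopologicalSpace
open scoped Topology ENNReal NNReal InnerProductSpace RealInnerProductSpace

set_option linter.dupNamespace false -- D-0017: `Summit.<S>.<S>.…` repeats the summit name by design

namespace Summit.NavierStokesRegularity.NavierStokesRegularity.Theorems.RellichScarScarRigidity

open Literature.Analysis.FluidPDE
open Summit.NavierStokesRegularity.NavierStokesRegularity.Theses.RellichScar
open Summit.NavierStokesRegularity.NavierStokesRegularity.Theorems.ScarRigidity.Negative
open MomentLadder

/-- Physical space. -/
local notation "ℝ³" => EuclideanSpace ℝ (Fin 3)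

/-- The open backward slab `(-∞,0) × ℝ³`. -/
local notation "𝕊" => Literature.Analysis.FluidPDE.slab (EuclideanSpace ℝ (Fin 3)) (Set.Iio (0 : ℝ)) isOpen_Iio

/-! ## Registered stubs -/

/-- **STUB S0 (= route item stmt-NavierStokesRegularity-11718, DELEGATED).**  `SymmetricScarExists` verbatim:
if a singular apex profile exists at some constant, one exists whose scar is (−1)-homogeneous or axisymmetric.
This line never works this stub; it is the sibling crux of the route and closes with it. -/
theorem stub_symmetricScarExists : SymmetricScarExists := by
  sorry

/-- **STUB S1 (OPEN core, held by the lead): local scar uniqueness = isolation among scar twins.**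
Every singular smooth apex profile `V` (Type-I ancient mild at constant `C`, apex bound, classical on `(−∞,0)`
with the scale-invariant package, backward-singular origin) admits `ε > 0` such that every singular smooth apex
profile `V'` at the same constant with the SAME SCAR and `‖V'(t,x) − V(t,x)‖ ≤ ε(−t)/(‖x‖+√(−t))³` on the whole
slab coincides with `V` on the slab.  (The small-difference form of the crux at a TRUE profile; card
`generator-hull-local-rigidity`.) -/
theorem stub_localScarUniqueness :
    ∀ (V : ℝ → ℝ³ → ℝ³) (Q : ℝ → ℝ³ → ℝ) (C : ℝ), 0 < C →
      IsTypeIAncientMild C V → HasTypeIDecay C V → IsClassicalNSSolutionOn (Iio (0 : ℝ)) 1 0 V Q →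
      ScaleInvariantBounds V Q → IsBackwardSingularPoint V 0 →
      ∃ ε : ℝ, 0 < ε ∧ ∀ (V' : ℝ → ℝ³ → ℝ³) (Q' : ℝ → ℝ³ → ℝ),
        IsTypeIAncientMild C V' → HasTypeIDecay C V' → IsClassicalNSSolutionOn (Iio (0 : ℝ)) 1 0 V' Q' →
        ScaleInvariantBounds V' Q' → IsBackwardSingularPoint V' 0 → SameScar V' V →
        (∀ t < 0, ∀ x : ℝ³, ‖V' t x - V t x‖ ≤ ε * ((-t) / (‖x‖ + Real.sqrt (-t)) ^ 3)) →
        ∀ t < 0, ∀ x : ℝ³, V' t x = V t x := by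
  sorry

/-! ### Platform stubs S2a/S2b/S3a/S3b — LANDED (wave 1, 2026-08-16): imported from the tree
`stub_dilationGeneratorFlat` (p129707, `…DilationGeneratorFlat.lean`), `stub_zoomOrbitIncrement` (p129650,
`…ZoomOrbitIncrement.lean`), `stub_rotationGeneratorFlat` (p130364, `…RotationGeneratorFlat.lean`),
`stub_rotationOrbitIncrement` (p129583, `…RotationOrbitIncrement.lean`). -/

/-! ## Glue (sorry-free) -/

namespace GeneratorHull

/-- The slab `(−∞,0) × ℝ³` is open. -/
theorem isOpen_slabSet : IsOpen (Iio (0 : ℝ) ×ˢ (univ : Set ℝ³)) := isOpen_Iio.prod isOpen_univ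

/-- The slab `(−∞,0) × ℝ³` is measurable. -/
theorem measurableSet_slabSet : MeasurableSet (Iio (0 : ℝ) ×ˢ (univ : Set ℝ³)) :=
  measurableSet_Iio.prod MeasurableSet.univ

/-- The weight `(−t)/(‖x‖+√(−t))³` is positive on the slab. -/
theorem weight_pos {t : ℝ} (ht : t < 0) (x : ℝ³) : 0 < (-t) / (‖x‖ + Real.sqrt (-t)) ^ 3 := by
  have hnt : 0 < -t := by linarith
  have hs : 0 < Real.sqrt (-t) := Real.sqrt_pos.2 hnt
  have hden : 0 < ‖x‖ + Real.sqrt (-t) := add_pos_of_nonneg_of_pos (norm_nonneg _) hs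
  exact div_pos hnt (pow_pos hden 3)

/-- Continuity of a rescaled field on the slab. -/
theorem continuousOn_uncurry_nsRescale {V : ℝ → ℝ³ → ℝ³}
    (hV : ContinuousOn (uncurry V) (Iio (0 : ℝ) ×ˢ (univ : Set ℝ³))) {lam : ℝ} (hlam : 0 < lam) :
    ContinuousOn (uncurry (nsRescale lam V)) (Iio (0 : ℝ) ×ˢ (univ : Set ℝ³)) := by
  have hΦ : Continuous fun z : ℝ × ℝ³ => ((lam ^ 2 * z.1, lam • z.2) : ℝ × ℝ³) := by fun_prop
  have hmaps : MapsTo (fun z : ℝ × ℝ³ => ((lam ^ 2 * z.1, lam • z.2) : ℝ × ℝ³))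
      (Iio (0 : ℝ) ×ˢ (univ : Set ℝ³)) (Iio (0 : ℝ) ×ˢ (univ : Set ℝ³)) := fun z hz =>
    ⟨show lam ^ 2 * z.1 < 0 from mul_neg_of_pos_of_neg (pow_pos hlam 2) hz.1, mem_univ _⟩
  refine ((hV.comp hΦ.continuousOn hmaps).const_smul lam).congr ?_
  rintro ⟨s, y⟩ -
  simp [nsRescale_apply]

/-- Continuity of a rotation-conjugated field on the slab. -/
theorem continuousOn_uncurry_conj {V : ℝ → ℝ³ → ℝ³}
    (hV : ContinuousOn (uncurry V) (Iio (0 : ℝ) ×ˢ (univ : Set ℝ³))) (θ : ℝ) :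
    ContinuousOn (uncurry fun t x => rotZ θ (V t (rotZ (-θ) x))) (Iio (0 : ℝ) ×ˢ (univ : Set ℝ³)) := by
  have hΦ : Continuous fun z : ℝ × ℝ³ => ((z.1, rotZ (-θ) z.2) : ℝ × ℝ³) :=
    continuous_fst.prodMk ((rotZLIE (-θ)).continuous.comp continuous_snd)
  have hmaps : MapsTo (fun z : ℝ × ℝ³ => ((z.1, rotZ (-θ) z.2) : ℝ × ℝ³))
      (Iio (0 : ℝ) ×ˢ (univ : Set ℝ³)) (Iio (0 : ℝ) ×ˢ (univ : Set ℝ³)) := fun z hz =>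
    ⟨hz.1, mem_univ _⟩
  have h1 : ContinuousOn (fun z : ℝ × ℝ³ => rotZ θ (uncurry V (z.1, rotZ (-θ) z.2)))
      (Iio (0 : ℝ) ×ˢ (univ : Set ℝ³)) :=
    (rotZLIE θ).continuous.comp_continuousOn (hV.comp hΦ.continuousOn hmaps)
  refine h1.congr ?_
  rintro ⟨s, y⟩ -
  simp [uncurry]

/-- A.e. equality on the slab is transported by the parabolic rescaling. -/
theorem ae_nsRescale_congr {u V : ℝ → ℝ³ → ℝ³}
    (hae : uncurry V =ᵐ[volume.restrict (Iio (0 : ℝ) ×ˢ (univ : Set ℝ³))] uncurry u)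
    {lam : ℝ} (hlam : 0 < lam) :
    uncurry (nsRescale lam V) =ᵐ[volume.restrict (Iio (0 : ℝ) ×ˢ (univ : Set ℝ³))]
      uncurry (nsRescale lam u) := by
  have hS := measurableSet_slabSet
  have hq := quasiMeasurePreserving_parabolicDilation hlam.ne'
  have hae' : ∀ᵐ z : ℝ × ℝ³ ∂volume, z ∈ Iio (0 : ℝ) ×ˢ (univ : Set ℝ³) → uncurry V z = uncurry u z :=
    (ae_restrict_iff' hS).1 hae
  refine (ae_restrict_iff' hS).2 ?_
  filter_upwards [hq.ae hae'] with z hz hzS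
  have := hz ⟨show lam ^ 2 * z.1 < 0 from mul_neg_of_pos_of_neg (pow_pos hlam 2) hzS.1, mem_univ _⟩
  simp only [uncurry, nsRescale_apply] at this ⊢
  rw [this]

/-- A.e. equality on the slab is transported by rotation-conjugation. -/
theorem ae_conj_congr {u V : ℝ → ℝ³ → ℝ³}
    (hae : uncurry V =ᵐ[volume.restrict (Iio (0 : ℝ) ×ˢ (univ : Set ℝ³))] uncurry u) (θ : ℝ) :
    uncurry (fun t x => rotZ θ (V t (rotZ (-θ) x)))
      =ᵐ[volume.restrict (Iio (0 : ℝ) ×ˢ (univ : Set ℝ³))]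
      uncurry (fun t x => rotZ θ (u t (rotZ (-θ) x))) := by
  have hS := measurableSet_slabSet
  have hΦ := (SymmetricScarExists.ScarWindow.measurePreserving_prodMap_rotZIso (-θ)).quasiMeasurePreserving
  have hae' : ∀ᵐ z : ℝ × ℝ³ ∂volume, z ∈ Iio (0 : ℝ) ×ˢ (univ : Set ℝ³) → uncurry V z = uncurry u z :=
    (ae_restrict_iff' hS).1 hae
  refine (ae_restrict_iff' hS).2 ?_
  filter_upwards [hΦ.ae hae'] with z hz hzS
  have := hz ⟨hzS.1, mem_univ _⟩
  simp only [uncurry, Prod.map, id, SymmetricScarExists.Negative.rotZIso_apply] at this ⊢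
  rw [this]

/-- From a.e. equality of two fields continuous on the slab to equality on the slab. -/
theorem eq_on_slab_of_ae_eq {V W : ℝ → ℝ³ → ℝ³}
    (hV : ContinuousOn (uncurry V) (Iio (0 : ℝ) ×ˢ (univ : Set ℝ³)))
    (hW : ContinuousOn (uncurry W) (Iio (0 : ℝ) ×ˢ (univ : Set ℝ³)))
    (hae : uncurry V =ᵐ[volume.restrict (Iio (0 : ℝ) ×ˢ (univ : Set ℝ³))] uncurry W) :
    ∀ t < 0, ∀ x : ℝ³, V t x = W t x := by
  intro t ht x
  have key := Measure.eqOn_open_of_ae_eq hae isOpen_slabSet hV hW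
    (show ((t, x) : ℝ × ℝ³) ∈ Iio (0 : ℝ) ×ˢ (univ : Set ℝ³) from ⟨ht, mem_univ _⟩)
  simpa using key

/-- **Scale-window ⇒ all scales** for EXACT self-similarity on the slab: if `λV(λ²t,λx) = V(t,x)` on the slab
for every `λ` in a neighbourhood of `1`, then for every `λ > 0` (the log-stabiliser is an open subgroup of the
connected group `ℝ`). -/
theorem selfSimilar_of_window {V : ℝ → ℝ³ → ℝ³} {δ : ℝ} (hδ : 0 < δ)
    (hwin : ∀ lam : ℝ, |lam - 1| < δ → 0 < lam → ∀ t < 0, ∀ x : ℝ³, nsRescale lam V t x = V t x) :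
    ∀ lam : ℝ, 0 < lam → ∀ t < 0, ∀ x : ℝ³, nsRescale lam V t x = V t x := by
  -- the stabiliser in log-scale
  let H : AddSubgroup ℝ :=
    { carrier := {a : ℝ | ∀ t < 0, ∀ x : ℝ³, nsRescale (Real.exp a) V t x = V t x}
      zero_mem' := by
        intro t _ x
        simp [nsRescale_apply]
      add_mem' := by
        intro a b ha hb t ht x
        have hea : 0 < Real.exp a := Real.exp_pos a
        have heb : 0 < Real.exp b := Real.exp_pos b
        have ht' : Real.exp b ^ 2 * t < 0 := mul_neg_of_pos_of_neg (pow_pos heb 2) ht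
        have h1 := ha (Real.exp b ^ 2 * t) ht' (Real.exp b • x)
        have h2 := hb t ht x
        simp only [nsRescale_apply] at h1 h2 ⊢
        rw [Real.exp_add, show (Real.exp a * Real.exp b) ^ 2 * t =
          Real.exp a ^ 2 * (Real.exp b ^ 2 * t) by ring, mul_comm (Real.exp a) (Real.exp b), mul_smul,
          mul_smul, smul_comm (Real.exp b) (Real.exp a) x, h1, h2]
      neg_mem' := by
        intro a ha t ht x
        have hea : 0 < Real.exp a := Real.exp_pos a
        have hena : 0 < Real.exp (-a) := Real.exp_pos (-a)
        have ht' : Real.exp (-a) ^ 2 * t < 0 := mul_neg_of_pos_of_neg (pow_pos hena 2) ht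
        have h1 := ha (Real.exp (-a) ^ 2 * t) ht' (Real.exp (-a) • x)
        simp only [nsRescale_apply] at h1 ⊢
        rw [smul_smul, ← mul_assoc, ← mul_pow, ← Real.exp_add, add_neg_cancel, Real.exp_zero,
          one_pow, one_mul, one_smul] at h1
        -- h1 : exp a • V t x = V (exp(-a)^2 t) (exp(-a) x)
        rw [← h1, smul_smul, ← Real.exp_add, neg_add_cancel, Real.exp_zero, one_smul] }
  have hH : ∀ a : ℝ, a ∈ (H : Set ℝ) ↔ ∀ t < 0, ∀ x : ℝ³, nsRescale (Real.exp a) V t x = V t x :=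
    fun a => Iff.rfl
  -- it contains a neighbourhood of `0`
  have hcont : ContinuousAt (fun a : ℝ => |Real.exp a - 1|) 0 :=
    ((Real.continuous_exp.sub continuous_const).abs).continuousAt
  have h0 : (fun a : ℝ => |Real.exp a - 1|) 0 < δ := by simpa using hδ
  have hnhds : (H : Set ℝ) ∈ 𝓝 (0 : ℝ) := by
    have hev : ∀ᶠ a in 𝓝 (0 : ℝ), |Real.exp a - 1| < δ := hcont.eventually (gt_mem_nhds h0)
    refine mem_of_superset hev fun a ha => ?_
    exact (hH a).2 (hwin _ ha (Real.exp_pos a))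
  have hopen : IsOpen (H : Set ℝ) := H.isOpen_of_mem_nhds hnhds
  have huniv : (H : Set ℝ) = univ :=
    IsClopen.eq_univ ⟨H.isClosed_of_isOpen hopen, hopen⟩ ⟨0, H.zero_mem⟩
  intro lam hlam
  have hmem : Real.log lam ∈ (H : Set ℝ) := huniv ▸ mem_univ _
  have := (hH _).1 hmem
  rwa [Real.exp_log hlam] at this

/-- **Angle-window ⇒ all angles** for EXACT axisymmetry on the slab. -/
theorem axisymmetric_of_window {V : ℝ → ℝ³ → ℝ³} {δ : ℝ} (hδ : 0 < δ)
    (hwin : ∀ θ : ℝ, |θ| < δ → ∀ t < 0, ∀ x : ℝ³, rotZ θ (V t (rotZ (-θ) x)) = V t x) :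
    ∀ θ : ℝ, ∀ t < 0, ∀ x : ℝ³, rotZ θ (V t (rotZ (-θ) x)) = V t x := by
  -- closure under addition
  have hadd : ∀ θ φ : ℝ, (∀ t < 0, ∀ x : ℝ³, rotZ θ (V t (rotZ (-θ) x)) = V t x) →
      (∀ t < 0, ∀ x : ℝ³, rotZ φ (V t (rotZ (-φ) x)) = V t x) →
      ∀ t < 0, ∀ x : ℝ³, rotZ (θ + φ) (V t (rotZ (-(θ + φ)) x)) = V t x := by
    intro θ φ hθ hφ t ht x
    have h1 := hφ t ht (rotZ (-θ) x)
    rw [rotZ_add, show -(θ + φ) = -φ + -θ by ring, rotZ_add, h1]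
    exact hθ t ht x
  -- natural multiples of small angles
  have hnsmul : ∀ (ψ : ℝ), |ψ| < δ → ∀ n : ℕ, ∀ t < 0, ∀ x : ℝ³,
      rotZ (n * ψ) (V t (rotZ (-(n * ψ)) x)) = V t x := by
    intro ψ hψ n
    induction n with
    | zero => intro t _ x; simp
    | succ n ih =>
      have := hadd (n * ψ) ψ ih (hwin ψ hψ)
      simpa [Nat.cast_succ, add_mul, one_mul] using this
  intro θ
  obtain ⟨n, hn⟩ := exists_nat_gt (|θ| / δ)
  have hnpos : (0 : ℝ) < n := lt_of_le_of_lt (div_nonneg (abs_nonneg θ) hδ.le) hn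
  have hψ : |θ / n| < δ := by
    rw [abs_div, abs_of_pos hnpos, div_lt_iff₀ hnpos]
    rw [div_lt_iff₀ hδ] at hn
    linarith [mul_comm δ (n : ℝ)]
  have h := hnsmul (θ / n) hψ n
  rwa [mul_div_cancel₀ _ hnpos.ne'] at h

end GeneratorHull

open GeneratorHull

/-! ## Composition -/

/-- **No singular apex profile has a (−1)-homogeneous scar** — from the stubs.  (Smooth representative and
package: `stub_apexMildRepresentative`, `stub_apexRegularity`; covariance of the apex class: the landed
`SimilarityCovariance`; isolation `stub_localScarUniqueness` freezes the zoom orbit near `λ = 1` by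
`stub_dilationGeneratorFlat` + `stub_zoomOrbitIncrement`; window ⇒ exact self-similarity; `SelfSimilarApexFatal`.) -/
theorem noHomogeneousScarProfile_of_stubs :
    ∀ (u : ℝ → ℝ³ → ℝ³) (p : ℝ → ℝ³ → ℝ) (G : ℝ → ℝ³ → ℝ³ →L[ℝ] ℝ³) (C : ℝ),
      IsSuitableWeakSolutionOn 𝕊 1 0 u p → HasWeakSpatialGradientOn 𝕊 u G →
      typeIBound (Iio (0 : ℝ) ×ˢ univ) u p G < ⊤ → HasTypeIDecay C u → IsBackwardSingularPoint u 0 →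
      (∀ lam : ℝ, 0 < lam → SameScar (nsRescale lam u) u) → False := by
  intro u p G C hs hg hI hd hsing hhom
  have hC : 0 < C := pos_const_of_apexSingular hd hsing
  obtain ⟨V, hae, hm, hdV⟩ := stub_apexMildRepresentative u p G C hC hs hg hI hd
  obtain ⟨Q, hcl, hB⟩ := stub_apexRegularity V C hC hm hdV
  have hsV : IsBackwardSingularPoint V 0 := isBackwardSingularPoint_congr_ae hae hsing
  have hVcont : ContinuousOn (uncurry V) (Iio (0 : ℝ) ×ˢ (univ : Set ℝ³)) := hm.continuousOn_uncurry
  -- the homogeneous scar passes to the representative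
  have hhomV : ∀ lam : ℝ, 0 < lam → SameScar (nsRescale lam V) V := fun lam hlam =>
    sameScar_congr_ae (ae_nsRescale_congr hae hlam) hae (hhom lam hlam)
  -- isolation radius and orbit Lipschitz constant
  obtain ⟨ε, hε, hiso⟩ := stub_localScarUniqueness V Q C hC hm hdV hcl hB hsV
  obtain ⟨K, hK⟩ := stub_dilationGeneratorFlat V Q C hC hm hdV hcl hB hhomV
  obtain ⟨K', hK'⟩ := stub_zoomOrbitIncrement V Q C K hC hm hdV hB hK
  -- the covariance of the apex class (landed support `SimilarityCovariance`)
  have hCov := RellichScarSimilarityCovariance.similarityCovariance_proof u p G C hs hg hI hd hsing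
  -- freezing the orbit in a window around `λ = 1`
  set δ : ℝ := min (1 / 2) (ε / (|K'| + 1)) with hδdef
  have hδ : 0 < δ := lt_min (by norm_num) (div_pos hε (by positivity))
  have hwin : ∀ lam : ℝ, |lam - 1| < δ → 0 < lam → ∀ t < 0, ∀ x : ℝ³, nsRescale lam V t x = V t x := by
    intro lam hlamδ hlam
    have hlamI : lam ∈ Icc (1 / 2 : ℝ) 2 := by
      have h1 : |lam - 1| < 1 / 2 := hlamδ.trans_le (min_le_left _ _)
      rw [abs_lt] at h1
      constructor <;> linarith [h1.1, h1.2]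
    -- smooth representative of the rescaled weak profile; it IS the rescaled representative on the slab
    obtain ⟨q₁, H₁, hs₁, hg₁, hI₁, hd₁, hsing₁⟩ := hCov.1 lam hlam
    obtain ⟨V₁, hae₁, hm₁, hdV₁⟩ := stub_apexMildRepresentative (nsRescale lam u) q₁ H₁ C hC hs₁ hg₁ hI₁ hd₁
    obtain ⟨Q₁, hcl₁, hB₁⟩ := stub_apexRegularity V₁ C hC hm₁ hdV₁
    have hsV₁ : IsBackwardSingularPoint V₁ 0 := isBackwardSingularPoint_congr_ae hae₁ hsing₁
    have haeV₁ : uncurry V₁ =ᵐ[volume.restrict (Iio (0 : ℝ) ×ˢ (univ : Set ℝ³))]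
        uncurry (nsRescale lam V) := hae₁.trans (ae_nsRescale_congr hae hlam).symm
    have hEq : ∀ t < 0, ∀ x : ℝ³, V₁ t x = nsRescale lam V t x :=
      eq_on_slab_of_ae_eq hm₁.continuousOn_uncurry (continuousOn_uncurry_nsRescale hVcont hlam) haeV₁
    have hscar₁ : SameScar V₁ V := sameScar_congr_ae hae₁ hae (hhom lam hlam)
    have hclose : ∀ t < 0, ∀ x : ℝ³, ‖V₁ t x - V t x‖ ≤ ε * ((-t) / (‖x‖ + Real.sqrt (-t)) ^ 3) := by
      intro t ht x
      rw [hEq t ht x]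
      refine (hK' lam hlamI t ht x).trans ?_
      refine mul_le_mul_of_nonneg_right ?_ (weight_pos ht x).le
      have h2 : |lam - 1| < ε / (|K'| + 1) := hlamδ.trans_le (min_le_right _ _)
      have hK'le : K' ≤ |K'| + 1 := (le_abs_self K').trans (by linarith)
      calc K' * |lam - 1| ≤ (|K'| + 1) * |lam - 1| :=
            mul_le_mul_of_nonneg_right hK'le (abs_nonneg _)
        _ ≤ (|K'| + 1) * (ε / (|K'| + 1)) := mul_le_mul_of_nonneg_left h2.le (by positivity)
        _ = ε := by field_simp
    intro t ht x
    rw [← hEq t ht x]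
    exact hiso V₁ Q₁ hm₁ hdV₁ hcl₁ hB₁ hsV₁ hscar₁ hclose t ht x
  -- all scales, then a.e. self-similarity of `u`, then Tsai
  have hall := selfSimilar_of_window hδ hwin
  refine rellichScar_selfSimilarApexFatal_proof u p G C hs hg hI hd hsing ?_
  intro lam hlam
  have hssV : uncurry (nsRescale lam V) =ᵐ[volume.restrict (Iio (0 : ℝ) ×ˢ (univ : Set ℝ³))] uncurry V :=
    ae_slab_of_forall (P := fun z => uncurry (nsRescale lam V) z = uncurry V z) fun t ht x => hall lam hlam t ht x
  exact ae_selfSimilar_of_ae_eq hae.symm hlam hssV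

/-- **No singular apex profile has an axisymmetric scar** — from the stubs (rotation orbit frozen near
`θ = 0` by `stub_rotationGeneratorFlat` + `stub_rotationOrbitIncrement` and isolation; window ⇒ exact
axisymmetry; `AxisymmetricApexFatal`). -/
theorem noAxisymmetricScarProfile_of_stubs :
    ∀ (u : ℝ → ℝ³ → ℝ³) (p : ℝ → ℝ³ → ℝ) (G : ℝ → ℝ³ → ℝ³ →L[ℝ] ℝ³) (C : ℝ),
      IsSuitableWeakSolutionOn 𝕊 1 0 u p → HasWeakSpatialGradientOn 𝕊 u G →
      typeIBound (Iio (0 : ℝ) ×ˢ univ) u p G < ⊤ → HasTypeIDecay C u → IsBackwardSingularPoint u 0 →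
      (∀ θ : ℝ, SameScar (fun t x => rotZ θ (u t (rotZ (-θ) x))) u) → False := by
  intro u p G C hs hg hI hd hsing hax
  have hC : 0 < C := pos_const_of_apexSingular hd hsing
  obtain ⟨V, hae, hm, hdV⟩ := stub_apexMildRepresentative u p G C hC hs hg hI hd
  obtain ⟨Q, hcl, hB⟩ := stub_apexRegularity V C hC hm hdV
  have hsV : IsBackwardSingularPoint V 0 := isBackwardSingularPoint_congr_ae hae hsing
  have hVcont : ContinuousOn (uncurry V) (Iio (0 : ℝ) ×ˢ (univ : Set ℝ³)) := hm.continuousOn_uncurry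
  have haxV : ∀ θ : ℝ, SameScar (fun t x => rotZ θ (V t (rotZ (-θ) x))) V := fun θ =>
    sameScar_congr_ae (ae_conj_congr hae θ) hae (hax θ)
  obtain ⟨ε, hε, hiso⟩ := stub_localScarUniqueness V Q C hC hm hdV hcl hB hsV
  obtain ⟨K, hK⟩ := stub_rotationGeneratorFlat V Q C hC hm hdV hcl hB haxV
  have hK' := stub_rotationOrbitIncrement V C K hm hK
  have hCov := RellichScarSimilarityCovariance.similarityCovariance_proof u p G C hs hg hI hd hsing
  set δ : ℝ := ε / (|K| + 1) with hδdef
  have hδ : 0 < δ := div_pos hε (by positivity)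
  have hwin : ∀ θ : ℝ, |θ| < δ → ∀ t < 0, ∀ x : ℝ³, rotZ θ (V t (rotZ (-θ) x)) = V t x := by
    intro θ hθ
    obtain ⟨q₁, H₁, hs₁, hg₁, hI₁, hd₁, hsing₁⟩ := hCov.2 θ
    obtain ⟨V₁, hae₁, hm₁, hdV₁⟩ :=
      stub_apexMildRepresentative (fun t x => rotZ θ (u t (rotZ (-θ) x))) q₁ H₁ C hC hs₁ hg₁ hI₁ hd₁
    obtain ⟨Q₁, hcl₁, hB₁⟩ := stub_apexRegularity V₁ C hC hm₁ hdV₁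
    have hsV₁ : IsBackwardSingularPoint V₁ 0 := isBackwardSingularPoint_congr_ae hae₁ hsing₁
    have haeV₁ : uncurry V₁ =ᵐ[volume.restrict (Iio (0 : ℝ) ×ˢ (univ : Set ℝ³))]
        uncurry (fun t x => rotZ θ (V t (rotZ (-θ) x))) := hae₁.trans (ae_conj_congr hae θ).symm
    have hEq : ∀ t < 0, ∀ x : ℝ³, V₁ t x = rotZ θ (V t (rotZ (-θ) x)) :=
      eq_on_slab_of_ae_eq hm₁.continuousOn_uncurry (continuousOn_uncurry_conj hVcont θ) haeV₁
    have hscar₁ : SameScar V₁ V := sameScar_congr_ae hae₁ hae (hax θ)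
    have hclose : ∀ t < 0, ∀ x : ℝ³, ‖V₁ t x - V t x‖ ≤ ε * ((-t) / (‖x‖ + Real.sqrt (-t)) ^ 3) := by
      intro t ht x
      rw [hEq t ht x]
      refine (hK' θ t ht x).trans ?_
      refine mul_le_mul_of_nonneg_right ?_ (weight_pos ht x).le
      have hKle : K ≤ |K| + 1 := (le_abs_self K).trans (by linarith)
      calc K * |θ| ≤ (|K| + 1) * |θ| := mul_le_mul_of_nonneg_right hKle (abs_nonneg _)
        _ ≤ (|K| + 1) * (ε / (|K| + 1)) := mul_le_mul_of_nonneg_left hθ.le (by positivity)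
        _ = ε := by field_simp
    intro t ht x
    rw [← hEq t ht x]
    exact hiso V₁ Q₁ hm₁ hdV₁ hcl₁ hB₁ hsV₁ hscar₁ hclose t ht x
  have hall := axisymmetric_of_window hδ hwin
  refine rellichScar_axisymmetricApexFatal_proof u p G C hs hg hI hd hsing ?_
  intro θ
  have h1 : uncurry (fun t x => rotZ θ (V t (rotZ (-θ) x)))
      =ᵐ[volume.restrict (Iio (0 : ℝ) ×ˢ (univ : Set ℝ³))] uncurry V :=
    ae_slab_of_forall (P := fun z => uncurry (fun t x => rotZ θ (V t (rotZ (-θ) x))) z = uncurry V z)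
      fun t ht x => hall θ t ht x
  exact ((ae_conj_congr hae θ).symm.trans h1).trans hae

/-- **The crux from the stubs.**  If `ScarRigidity` failed, a singular apex profile would exist
(`exists_singular_apex_of_not_scarRigidity`); `stub_symmetricScarExists` (item 11718) upgrades it to one with a
homogeneous or axisymmetric scar, and the two theorems above exclude both. -/
theorem ScarRigidity_of : ScarRigidity := by
  by_contra h
  obtain ⟨C, u, p, G, _, hs, hg, hI, hd, hsing⟩ := exists_singular_apex_of_not_scarRigidity h
  obtain ⟨C', z, pz, Gz, hsz, hgz, hIz, hdz, hsingz, hsym⟩ :=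
    stub_symmetricScarExists C ⟨u, p, G, hs, hg, hI, hd, hsing⟩
  rcases hsym with hhom | hax
  · exact noHomogeneousScarProfile_of_stubs z pz Gz C' hsz hgz hIz hdz hsingz hhom
  · exact noAxisymmetricScarProfile_of_stubs z pz Gz C' hsz hgz hIz hdz hsingz hax

end Summit.NavierStokesRegularity.NavierStokesRegularity.Theorems.RellichScarScarRigidity

end
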